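import Summits.ResolutionOfSingularities.ResolutionOfSingularities.Theorems.FrobeniusClosingSteerDivisorTriggerTwoChart
import Literature.AlgebraicGeometry.Resolution.RegularLocalHeights
import HarnessLib

/-!
# No equimultiple regular plane at a point step, `p = 2` (B13a-2 of res-L0-w41-strat-2's σ-residual HIGH slate)

W4.1, crux `Steer` (stmt-ResolutionOfSingularities-16345), σ-line at `p = 2`, regime re-cut §σ2.15/§σ2.16
(res-L0-w41-strat-2, `R2TwoSigma-s16-strat2.delta.lean` rev 8 9b8bc57484cdc9e7, stub **B13a-2**
`noEquimultiplePlane_pointStep_two`; prover plan `L/res-L0-w41-strat-2/STUBPLAN-B13.md` 3694d2e9b5fb5288 §B13a-2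
E1–E5; res-L0-w41-plan-1 RULINGS 8–12 + DEALS 2026-08-27T07:55:08Z «B13a-2 → res-type-072»). Theses-free, def-free
helper (`--supports stmt-ResolutionOfSingularities-16345 --as helper`); seat res-type-072.

OURS (campaign `res-hironaka`, rung L ★L-G4, slot W4.1; a statement about the route's own objects; it replaces the
role of no printed item and is NOT a statement of the manuscript under review [claim: Hironaka2017, status:
under-review]; AI review is weaker than expert review).

## The statement

Let `K` be a field of characteristic `2`, `R ⊆ K` a REGULAR LOCAL subring of Krull dimension `4`, `f = s² ∈ R` a
radicand whose generic torsor fibre is a field (`s·z ≠ y` for all `y, z ∈ R`, `z ≠ 0`), such that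

* no height-one prime of `R` is singular for `T² = f` (B4 `noHeightOneCarrier_two` of the slate), and
* σ_top takes the POINT STEP at `R` — no σ_top-permissible positive-dimensional centre exists (the second disjunct
  of the skeleton's `IsSigmaTopCentre R 2 f 𝔪`).

Then NO prime `Q ⊂ R` with `R/Q` regular of dimension `2` and NO global `g ∈ R` satisfy `f − g² ∈ Q²`
(`not_sub_sq_mem_sq_of_noPermissible`, and `not_sub_sq_mem_sq_of_sigmaTop` in the form the skeleton's point step
provides).

## Proof (STUBPLAN-B13 §B13a-2, all bricks in the tree)

Suppose `f − g² ∈ Q²`. (E1) `Q` is a SINGULAR prime: `f − g² ∈ Q² ⊆ (Q R_Q)²` and res-type-082's criterion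
(`AutoPermissible.singular_atPrime_of_sub_pow_mem_sq`, p505361). (E3, heights) In the regular local ring `R`,
`ht Q + dim R/Q = dim R` (`height_add_ringKrullDim_quotient`, Matsumura §5 p. 31), so `ht Q = 2`. (E2) `Q` is
MINIMAL among singular primes: a singular prime `Q' < Q` has `ht Q' < 2`; `ht Q' = 0` means `Q' = ⊥`, but the
generic fibre is regular (`DivisorTrigger.isRegularLocalRing_adjoinRoot_bot`, p510711, from `hirr`); `ht Q' = 1`
is excluded by hypothesis. (E3) `Q` has MAXIMAL DIMENSION among (minimal) singular primes: every singular prime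
`Q'` has `ht Q' ≥ 2` by the same two exclusions, hence `dim R/Q' = 4 − ht Q' ≤ 2 = dim R/Q`. (E4) `Q ≠ 𝔪` since
`dim R/𝔪 = 0 ≠ 2`; with `R/Q` regular and the GIVEN global cleaner `g` (at `p = 2`, `Q² = Q^p`) the prime `Q` is
σ_top-PERMISSIBLE — the body of the skeleton's `IsPermissibleCentre R 2 f Q` holds. (E5) This contradicts the point
step. ∎

## What is proved (namespace `…Theorems.SwitchingDichotomy.NoEquimultiplePlane`)
* `exists_nat_height_add_eq` — `ht Q + dim S/Q = dim S` in natural numbers for a prime of a regular local ring of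
  dimension `n` (bookkeeping form of the tree's `height_add_ringKrullDim_quotient`).
* `ringKrullDim_quotient_maximalIdeal` — `dim S/𝔪 = 0`.
* `two_le_height_of_singular` — under `hirr` and «no singular height-one prime», every singular prime has height
  `≥ 2` (E2/E3's exclusions).
* `not_sub_sq_mem_sq_of_noPermissible` — B13a-2 with the skeleton's §σ2 bodies (`IsSingPrime`, `IsTopSingComponent`,
  `IsPermissibleCentre`, `RadicandRing` of res-L0-w41-lead-1's `Steer_r23.lean` 08fdfe1a18d6e54c §3.2) UNFOLDED as
  printed there at `p := 2`, hypothesis «no permissible centre».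
* `not_sub_sq_mem_sq_of_sigmaTop` — the same from the body of `IsSigmaTopCentre R 2 f P` at `P = 𝔪` (what
  `IsSteeredRun` + `IsPointStep` hand the holder), so that the in-skeleton leaf for strat-2's literal signature is
  `obtain ⟨_, hs', hσ, -, -⟩ := hrun.2 i; obtain ⟨_, hPi⟩ := hpt; exact not_sub_sq_mem_sq_of_sigmaTop K (R i) hdim
  ⟨s i ^ 2, hs⟩ (s i) rfl hirr hno1 (P i) hPi hσ Q g ‹_› ‹_›` (`IsLocalRing` is a Prop, so the instances agree).

No Theses file is imported; nothing here is a route item or a registration.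
[cite: Matsumura1987, §5 p. 31, Thm. 14.2, Thm. 19.3] [folklore]
-/

noncomputable section

-- `Summit.<S>.<S>.…` duplicates the summit name by design (single-problem summit).
set_option linter.dupNamespace false

open Polynomial IsLocalRing Literature.AlgebraicGeometry.Resolution

namespace Summit.ResolutionOfSingularities.ResolutionOfSingularities.Theorems.SwitchingDichotomy.NoEquimultiplePlane

universe u

/-! ## §1 Height bookkeeping in a regular local ring -/

section Heights

variable {S : Type u} [CommRing S] [IsRegularLocalRing S]

/-- **Dimension formula in natural numbers**: for a prime `Q` of a regular local ring `S` of Krull dimension `n`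
there are `q d : ℕ` with `ht Q = q`, `dim S/Q = d` and `q + d = n` (the tree's `height_add_ringKrullDim_quotient`,
Matsumura §5 p. 31, with the finiteness of both summands made explicit). [cite: Matsumura1987, §5 p. 31] -/
theorem exists_nat_height_add_eq (Q : Ideal S) [hQ : Q.IsPrime] (n : ℕ) (hn : ringKrullDim S = n) :
    ∃ q d : ℕ, Q.height = q ∧ ringKrullDim (S ⧸ Q) = d ∧ q + d = n := by
  haveI : Nontrivial (S ⧸ Q) := Ideal.Quotient.nontrivial_iff.mpr hQ.ne_top
  haveI : IsLocalRing (S ⧸ Q) := .of_surjective' _ Ideal.Quotient.mk_surjective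
  obtain ⟨d, hd⟩ := exists_nat_cast_eq_ringKrullDim (R := S ⧸ Q)
  obtain ⟨q, hq⟩ := ENat.ne_top_iff_exists.mp (Q.height_ne_top hQ.ne_top)
  have hformula := height_add_ringKrullDim_quotient Q
  rw [← hq, hd, hn] at hformula
  refine ⟨q, d, hq.symm, hd, ?_⟩
  have h : ((q + d : ℕ) : WithBot ℕ∞) = n := by
    rw [← hformula]
    rfl
  exact_mod_cast h

omit [IsRegularLocalRing S] in
/-- The residue field of a local ring has Krull dimension `0`. [folklore] -/
theorem ringKrullDim_quotient_maximalIdeal [IsLocalRing S] : ringKrullDim (S ⧸ maximalIdeal S) = 0 :=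
  ringKrullDim_eq_zero_of_isField
    ((Ideal.Quotient.maximal_ideal_iff_isField_quotient (maximalIdeal S)).mp inferInstance)

end Heights

/-! ## §2 Singular primes have height `≥ 2` under `hirr` and B4 -/

section Two

variable (K : Type) [Field K]

/-- **E2/E3's exclusions.** For a regular local subring `R ⊆ K` (`char K = 2`), `f = s²` with `s·z ≠ y` for all
`y, z ∈ R`, `z ≠ 0` (the generic torsor fibre is a field), and no singular height-one prime: every prime `Q'` at
which the torsor `T² = f` is SINGULAR (the skeleton's `IsSingPrime R 2 f Q'` unfolded) has height `≠ 0` (`⊥` is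
regular for the torsor, `DivisorTrigger.isRegularLocalRing_adjoinRoot_bot`) and `≠ 1` (hypothesis), i.e. `2 ≤ ht Q'`.
[cite: Matsumura1987, Thm. 14.2] [folklore] -/
theorem two_le_height_of_singular [CharP K 2] (R : Subring K) [IsRegularLocalRing R] (f : R) (s : K)
    (hf : (f : K) = s ^ 2) (hirr : ∀ y z : R, (z : K) ≠ 0 → s * z ≠ y)
    (hno1 : ∀ (Q : Ideal R) [Q.IsPrime], Q.height = 1 →
      ¬ ¬ IsRegularLocalRing
        (AdjoinRoot (X ^ 2 - C (algebraMap R (Localization.AtPrime Q) f) : (Localization.AtPrime Q)[X])))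
    (Q' : Ideal R) [Q'.IsPrime]
    (hsing : ¬ IsRegularLocalRing
      (AdjoinRoot (X ^ 2 - C (algebraMap R (Localization.AtPrime Q') f) : (Localization.AtPrime Q')[X])))
    {q : ℕ} (hq : Q'.height = q) : 2 ≤ q := by
  have hq0 : q ≠ 0 := by
    rintro rfl
    have hbot : Q' = ⊥ := Ideal.height_eq_zero_iff_eq_bot.mp (by rw [hq, Nat.cast_zero])
    subst hbot
    exact hsing (DivisorTrigger.isRegularLocalRing_adjoinRoot_bot 2 R f s hf hirr)
  have hq1 : q ≠ 1 := by
    rintro rfl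
    exact hno1 Q' (by rw [hq, Nat.cast_one]) hsing
  omega

/-! ## §3 B13a-2: no equimultiple regular plane when no permissible centre exists -/

/-- **B13a-2 · NO EQUIMULTIPLE REGULAR PLANE when σ_top has no permissible centre** (`p = 2`; the skeleton's §σ2
bodies of `IsSingPrime` / `IsTopSingComponent` / `IsPermissibleCentre` / `RadicandRing` UNFOLDED at `p := 2`, as in
`AutoPermissible.isPermissibleCentre_two_iff`). For a field `K` of characteristic `2`, a regular local subring
`R ⊆ K` of Krull dimension `4`, a radicand `f = s² ∈ R` whose generic fibre is a field (`hirr`), with no singular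
height-one prime (`hno1`) and NO σ_top-permissible centre (`hnoperm`): no prime `Q` with `R/Q` regular of dimension
`2` and no `g ∈ R` have `f − g² ∈ Q²`. Indeed such a `Q` would be singular (`f − g² ∈ Q²`, res-type-082's criterion),
minimal among singular primes and of maximal dimension among them (all singular primes have height `≥ 2`,
`two_le_height_of_singular`, and `ht + dim = 4`), `≠ 𝔪` (`dim R/𝔪 = 0`), with regular quotient and a global
cleaner: a permissible centre. OURS. [cite: Matsumura1987, §5 p. 31, Thm. 14.2, Thm. 19.3] [folklore] -/
theorem not_sub_sq_mem_sq_of_noPermissible [CharP K 2] (R : Subring K) [IsRegularLocalRing R]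
    (hdim : ringKrullDim R = 4) (f : R) (s : K) (hf : (f : K) = s ^ 2)
    (hirr : ∀ y z : R, (z : K) ≠ 0 → s * z ≠ y)
    (hno1 : ∀ (Q : Ideal R) [Q.IsPrime], Q.height = 1 →
      ¬ ¬ IsRegularLocalRing
        (AdjoinRoot (X ^ 2 - C (algebraMap R (Localization.AtPrime Q) f) : (Localization.AtPrime Q)[X])))
    (hnoperm : ∀ Q : Ideal R,
      ¬ (Q ≠ maximalIdeal R ∧
          (∃ _ : Q.IsPrime,
            ¬ IsRegularLocalRing
                (AdjoinRoot (Polynomial.X ^ 2 - Polynomial.C (algebraMap R (Localization.AtPrime Q) f))) ∧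
              (∀ (Q' : Ideal R) [Q'.IsPrime],
                ¬ IsRegularLocalRing
                    (AdjoinRoot (Polynomial.X ^ 2 -
                      Polynomial.C (algebraMap R (Localization.AtPrime Q') f))) →
                  Q' ≤ Q → Q' = Q) ∧
              (∀ (Q' : Ideal R) [Q'.IsPrime],
                ¬ IsRegularLocalRing
                    (AdjoinRoot (Polynomial.X ^ 2 -
                      Polynomial.C (algebraMap R (Localization.AtPrime Q') f))) →
                  (∀ (Q'' : Ideal R) [Q''.IsPrime],
                    ¬ IsRegularLocalRing
                        (AdjoinRoot (Polynomial.X ^ 2 -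
                          Polynomial.C (algebraMap R (Localization.AtPrime Q'') f))) →
                      Q'' ≤ Q' → Q'' = Q') →
                  ringKrullDim (R ⧸ Q') ≤ ringKrullDim (R ⧸ Q))) ∧
          IsRegularLocalRing (R ⧸ Q) ∧ ∃ g : R, f - g ^ 2 ∈ Q ^ 2))
    (Q : Ideal R) [hQ : Q.IsPrime] (g : R) (hQreg : IsRegularLocalRing (R ⧸ Q))
    (hQdim : ringKrullDim (R ⧸ Q) = 2) : f - g ^ 2 ∉ Q ^ 2 := by
  intro hg
  have hdim' : ringKrullDim R = ((4 : ℕ) : WithBot ℕ∞) := by rw [hdim]; rfl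
  -- (E1) `Q` is a singular prime
  have hsing : ¬ IsRegularLocalRing
      (AdjoinRoot (X ^ 2 - C (algebraMap R (Localization.AtPrime Q) f) : (Localization.AtPrime Q)[X])) :=
    AutoPermissible.singular_atPrime_of_sub_pow_mem_sq K 2 R f Q hg
  -- heights: `ht Q = 2`
  obtain ⟨q, d, hq, hd, hqd⟩ := exists_nat_height_add_eq Q 4 hdim'
  have hd2 : d = 2 := by
    have h : (d : WithBot ℕ∞) = 2 := hd.symm.trans hQdim
    exact_mod_cast h
  have hq2 : q = 2 := by omega
  subst hq2
  -- (E4) `Q ≠ 𝔪`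
  have hQne : Q ≠ maximalIdeal R := by
    rintro rfl
    rw [ringKrullDim_quotient_maximalIdeal] at hd
    have h0 : (0 : ℕ) = d := by exact_mod_cast hd
    omega
  -- (E2) `Q` is minimal among singular primes
  have hmin : ∀ (Q' : Ideal R) [Q'.IsPrime],
      ¬ IsRegularLocalRing
          (AdjoinRoot (Polynomial.X ^ 2 - Polynomial.C (algebraMap R (Localization.AtPrime Q') f))) →
        Q' ≤ Q → Q' = Q := by
    intro Q' _ hQ's hle
    by_contra hne
    have hlt : Q'.height < Q.height := Ideal.height_strict_mono_of_isPrime_of_isPrime (lt_of_le_of_ne hle hne)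
    obtain ⟨q', d', hq', -, -⟩ := exists_nat_height_add_eq Q' 4 hdim'
    have h2 := two_le_height_of_singular K R f s hf hirr hno1 Q' hQ's hq'
    rw [hq, hq'] at hlt
    have hlt' : q' < 2 := by exact_mod_cast hlt
    omega
  -- (E3) `Q` has maximal dimension among the minimal singular primes
  have hmax : ∀ (Q' : Ideal R) [Q'.IsPrime],
      ¬ IsRegularLocalRing
          (AdjoinRoot (Polynomial.X ^ 2 - Polynomial.C (algebraMap R (Localization.AtPrime Q') f))) →
        (∀ (Q'' : Ideal R) [Q''.IsPrime],
          ¬ IsRegularLocalRing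
              (AdjoinRoot (Polynomial.X ^ 2 - Polynomial.C (algebraMap R (Localization.AtPrime Q'') f))) →
            Q'' ≤ Q' → Q'' = Q') →
        ringKrullDim (R ⧸ Q') ≤ ringKrullDim (R ⧸ Q) := by
    intro Q' _ hQ's _hmin'
    obtain ⟨q', d', hq', hd', hqd'⟩ := exists_nat_height_add_eq Q' 4 hdim'
    have h2 := two_le_height_of_singular K R f s hf hirr hno1 Q' hQ's hq'
    have hd'le : d' ≤ 2 := by omega
    rw [hd', hQdim]
    exact_mod_cast hd'le
  -- (E5) `Q` is a permissible centre: contradiction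
  exact hnoperm Q ⟨hQne, ⟨hQ, hsing, hmin, hmax⟩, hQreg, g, hg⟩

/-- **B13a-2 at a POINT STEP, in the form the skeleton provides** (`hσ` is the body of
`IsSigmaTopCentre R 2 f P` of res-L0-w41-lead-1's `Steer_r23.lean` §3.2 — first disjunct `IsPermissibleCentre R 2 f P`
unfolded, second disjunct «point step» — and `hP : P = 𝔪` is `IsPointStep`): the first disjunct is impossible at
`P = 𝔪` (its first clause is `P ≠ 𝔪`), so no permissible centre exists and `not_sub_sq_mem_sq_of_noPermissible`
applies. Strat-2's literal stub `noEquimultiplePlane_pointStep_two` (delta rev 8 l.94–110) follows in the skeleton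
by `obtain ⟨_, hs', hσ, -, -⟩ := hrun.2 i; obtain ⟨_, hPi⟩ := hpt; exact not_sub_sq_mem_sq_of_sigmaTop K (R i) hdim
⟨s i ^ 2, hs⟩ (s i) rfl hirr hno1 (P i) hPi hσ Q g ‹_› ‹_›`. OURS.
[cite: Matsumura1987, §5 p. 31, Thm. 14.2, Thm. 19.3] [folklore] -/
theorem not_sub_sq_mem_sq_of_sigmaTop [CharP K 2] (R : Subring K) [IsRegularLocalRing R]
    (hdim : ringKrullDim R = 4) (f : R) (s : K) (hf : (f : K) = s ^ 2)
    (hirr : ∀ y z : R, (z : K) ≠ 0 → s * z ≠ y)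
    (hno1 : ∀ (Q : Ideal R) [Q.IsPrime], Q.height = 1 →
      ¬ ¬ IsRegularLocalRing
        (AdjoinRoot (X ^ 2 - C (algebraMap R (Localization.AtPrime Q) f) : (Localization.AtPrime Q)[X])))
    (P : Ideal R) (hP : P = maximalIdeal R)
    (hσ : (P ≠ maximalIdeal R ∧
          (∃ _ : P.IsPrime,
            ¬ IsRegularLocalRing
                (AdjoinRoot (Polynomial.X ^ 2 - Polynomial.C (algebraMap R (Localization.AtPrime P) f))) ∧
              (∀ (Q' : Ideal R) [Q'.IsPrime],
                ¬ IsRegularLocalRing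
                    (AdjoinRoot (Polynomial.X ^ 2 -
                      Polynomial.C (algebraMap R (Localization.AtPrime Q') f))) →
                  Q' ≤ P → Q' = P) ∧
              (∀ (Q' : Ideal R) [Q'.IsPrime],
                ¬ IsRegularLocalRing
                    (AdjoinRoot (Polynomial.X ^ 2 -
                      Polynomial.C (algebraMap R (Localization.AtPrime Q') f))) →
                  (∀ (Q'' : Ideal R) [Q''.IsPrime],
                    ¬ IsRegularLocalRing
                        (AdjoinRoot (Polynomial.X ^ 2 -
                          Polynomial.C (algebraMap R (Localization.AtPrime Q'') f))) →
                      Q'' ≤ Q' → Q'' = Q') →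
                  ringKrullDim (R ⧸ Q') ≤ ringKrullDim (R ⧸ P))) ∧
          IsRegularLocalRing (R ⧸ P) ∧ ∃ g : R, f - g ^ 2 ∈ P ^ 2) ∨
        (P = maximalIdeal R ∧
          (∀ Q : Ideal R,
            ¬ (Q ≠ maximalIdeal R ∧
                (∃ _ : Q.IsPrime,
                  ¬ IsRegularLocalRing
                      (AdjoinRoot (Polynomial.X ^ 2 -
                        Polynomial.C (algebraMap R (Localization.AtPrime Q) f))) ∧
                    (∀ (Q' : Ideal R) [Q'.IsPrime],
                      ¬ IsRegularLocalRing
                          (AdjoinRoot (Polynomial.X ^ 2 -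
                            Polynomial.C (algebraMap R (Localization.AtPrime Q') f))) →
                        Q' ≤ Q → Q' = Q) ∧
                    (∀ (Q' : Ideal R) [Q'.IsPrime],
                      ¬ IsRegularLocalRing
                          (AdjoinRoot (Polynomial.X ^ 2 -
                            Polynomial.C (algebraMap R (Localization.AtPrime Q') f))) →
                        (∀ (Q'' : Ideal R) [Q''.IsPrime],
                          ¬ IsRegularLocalRing
                              (AdjoinRoot (Polynomial.X ^ 2 -
                                Polynomial.C (algebraMap R (Localization.AtPrime Q'') f))) →
                            Q'' ≤ Q' → Q'' = Q') →
                        ringKrullDim (R ⧸ Q') ≤ ringKrullDim (R ⧸ Q))) ∧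
                IsRegularLocalRing (R ⧸ Q) ∧ ∃ g : R, f - g ^ 2 ∈ Q ^ 2)) ∧
          ∃ g : R, f - g ^ 2 ∈ maximalIdeal R ^ 2)) :
    ∀ (Q : Ideal R) [Q.IsPrime] (g : R), IsRegularLocalRing (R ⧸ Q) → ringKrullDim (R ⧸ Q) = 2 →
      f - g ^ 2 ∉ Q ^ 2 := by
  intro Q _ g hQreg hQdim
  refine not_sub_sq_mem_sq_of_noPermissible K R hdim f s hf hirr hno1 ?_ Q g hQreg hQdim
  rcases hσ with h | ⟨-, h, -⟩
  · exact absurd hP h.1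
  · exact h

end Two

end Summit.ResolutionOfSingularities.ResolutionOfSingularities.Theorems.SwitchingDichotomy.NoEquimultiplePlane

end
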